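import Mathlib.Analysis.Complex.ExponentialBounds
import Mathlib.Analysis.SpecialFunctions.Pow.Real
import HarnessLib

/-!
# Route `UnitScaleTilt`, crux K1 «MinimiserStabilityRegPr» (stmt-QuantumFields-19200), (K2)-storey, pen D2 (numerics):
# **THE TWO K-FREE ESTIMATES BEHIND THE GREEN-KERNEL FAMILY** — pure real arithmetic, no lattice objects

Cell `ym3-torus` (HUMAN RULING D-0037; rung R3 = SU(2) YM₃ on T³ — NOT d = 4, NOT infinite volume, NOT a mass gap, NOT Clay).  Width seat `ym3-torus-px16` g13
(`--supports stmt-QuantumFields-19200 --as helper`).  THEOREMS ONLY (0 `def`, 0 `sorry`, default heartbeats); count-neutral.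

WHY.  The member theorems ✓`kernelRow_GT_DeltaEtaSlot_of_lift_abs` (A2i), ✓∕⧗`blockColumn_GT_DeltaEtaSlot_of_lift_abs`, `norm_symm_GT_apply_le_of_lift_abs` display (i) the condition
`0 < Θ` with A2g's phase-class constant `θ_V` (which carries the member's `ℓ = L^{K−n}`, `c₀`, `cB`, the coupling `a` and the `hk_D` constant `CkD`) and (ii) a conclusion constant
`A₂` built from the same letters.  The Idx∕family edition (L-only constants) needs: (E1) `θ_V ≤ r·T + 10⁵·ε₀` with `T = T(a₁, C_K, δ_K)` member-free, once `a ≤ a₁(c₀∕cB)ℓ³`,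
`CkD = C_K·ℓ⁻³`, `μ′ = δ_K`, `r ≤ min ¼ (δ_K∕2)`; (E2) `2A₂ ≤ C_G(γ, C_K, δ_K, a₁, r)` member-free once moreover `Θ ≥ γ∕2` and `ε₀ ≤ 10⁻⁵`.  Both are the bookkeeping
«`ℓ³ × ℓ⁻³ = 1`» of print's (3.46)–(3.49) (the averaging `Q_k` carries `ℓ⁻³`, the block volume `ℓ³`), written out.
WHAT IS PROVED (ns `Summit.QuantumFields.YangMills.Theorems.Prop7OneFormGreenKFreeNumerics`): private numeric atoms (`exp_half_le_two`, `exp_three_quarters_le_three`, `exp_two_le`,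
`sqrt_two_le`, `sqrt_216_le`, `exp_four_mul_sub_one_le` — file-local, the tree has many namesakes), the two cancellation identities (`sqrt_vol_mul_sqrt_mass_eq`, `sqrt_inv_vol_mul_sqrt_mass_eq`), ★★ `thetaV_le_kfree` (E1),
★★ `twoA₂_le_kfree` (E2), ★ `hsmall_le_half` (the window `(32√2ε₀e^{5r})(8e^{3r})·14 ≤ ½` at `ε₀ ≤ 10⁻⁵`, `r ≤ ¼`), ★★ `theta_ge_half_of_budgets` (Θ ≥ γ∕2 from the four quarter-budgets), ★ `rbudget_le`, ★ `CV_abs_le`.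
HONEST SCOPE.  Real-number inequalities only; nothing of the crux, EX, or any row is proved here; no summit is proved by a helper.

References: T. Bałaban, CMP **99** (1985) 389–434 [Balaban1985BackgroundPropagators] ((3.46)–(3.49) pp.398–399 — the source of the `ℓ⁻³`∕`ℓ³` bookkeeping).
-/

set_option autoImplicit false

noncomputable section

namespace Summit.QuantumFields.YangMills.Theorems.Prop7OneFormGreenKFreeNumerics

/-! ## §1 Numeric atoms -/

/-- `e^{1∕2} ≤ 2` (from `e < 2.72`). [folklore] -/
private theorem exp_half_le_two : Real.exp (1 / 2) ≤ 2 := by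
  have h1 : Real.exp (1 / 2) ^ 2 = Real.exp 1 := by rw [← Real.exp_nat_mul]; norm_num
  have h2 : Real.exp 1 < 4 := lt_trans Real.exp_one_lt_d9 (by norm_num)
  nlinarith [Real.exp_pos (1 / 2)]

/-- `e^{3∕4} ≤ 3`. [folklore] -/
private theorem exp_three_quarters_le_three : Real.exp (3 / 4) ≤ 3 :=
  le_trans (Real.exp_le_exp.mpr (by norm_num)) (le_trans Real.exp_one_lt_d9.le (by norm_num))

/-- `e² ≤ 7.39`. [folklore] -/
private theorem exp_two_le : Real.exp 2 ≤ 7.39 := by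
  have h1 : Real.exp 2 = Real.exp 1 ^ 2 := by rw [← Real.exp_nat_mul]; norm_num
  rw [h1]
  nlinarith [Real.exp_one_lt_d9, Real.exp_pos 1]

/-- `√2 ≤ 3∕2`. [folklore] -/
private theorem sqrt_two_le : Real.sqrt 2 ≤ 3 / 2 := by
  rw [Real.sqrt_le_left (by norm_num)]; norm_num

/-- `√216 ≤ 15`. [folklore] -/
private theorem sqrt_216_le : Real.sqrt 216 ≤ 15 := by
  rw [Real.sqrt_le_left (by norm_num)]; norm_num

/-- `0 ≤ e^{x} − 1` for `0 ≤ x`. [folklore] -/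
private theorem exp_sub_one_nonneg {x : ℝ} (hx : 0 ≤ x) : 0 ≤ Real.exp x - 1 := by linarith [Real.one_le_exp hx]

/-- `e^{4r} − 1 ≤ 8r` for `0 ≤ r ≤ ¼` (✓`Real.abs_exp_sub_one_le`). [folklore] -/
private theorem exp_four_mul_sub_one_le {r : ℝ} (hr : 0 ≤ r) (hr4 : r ≤ 1 / 4) : Real.exp (4 * r) - 1 ≤ 8 * r := by
  have h4 : 0 ≤ 4 * r := by linarith
  have h : |4 * r| ≤ 1 := by rw [abs_of_nonneg h4]; linarith
  have h1 : 0 ≤ Real.exp (4 * r) - 1 := exp_sub_one_nonneg h4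
  have := Real.abs_exp_sub_one_le h
  rw [abs_of_nonneg h1, abs_of_nonneg h4] at this
  linarith

/-! ## §2 The two cancellation identities `ℓ³ × ℓ⁻³` -/

/-- `√(3ℓ₃∕c₀)·√(2c₀(3ℓ₃)) = 3√2·ℓ₃` (`ℓ₃ ≥ 0`, `c₀ > 0`). [cite: Balaban1985BackgroundPropagators, (3.46)–(3.49) pp.398–399] -/
theorem sqrt_vol_mul_sqrt_mass_eq {c₀ ℓ₃ : ℝ} (hc₀ : 0 < c₀) (hℓ : 0 ≤ ℓ₃) :
    Real.sqrt (3 * ℓ₃ / c₀) * Real.sqrt (2 * c₀ * (3 * ℓ₃)) = 3 * Real.sqrt 2 * ℓ₃ := by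
  rw [← Real.sqrt_mul (by positivity)]
  have h : 3 * ℓ₃ / c₀ * (2 * c₀ * (3 * ℓ₃)) = (3 * Real.sqrt 2 * ℓ₃) ^ 2 := by
    rw [mul_pow, mul_pow, Real.sq_sqrt (by norm_num : (0:ℝ) ≤ 2)]; field_simp
  rw [h, Real.sqrt_sq (by positivity)]

/-- `√(3³·8∕(c₀ℓ₃))·√(2c₀(3ℓ₃)) = 36` (`ℓ₃ > 0`, `c₀ > 0`). [cite: Balaban1985BackgroundPropagators, (3.46)–(3.49) pp.398–399] -/
theorem sqrt_inv_vol_mul_sqrt_mass_eq {c₀ ℓ₃ : ℝ} (hc₀ : 0 < c₀) (hℓ : 0 < ℓ₃) :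
    Real.sqrt (3 ^ 3 * 8 / (c₀ * ℓ₃)) * Real.sqrt (2 * c₀ * (3 * ℓ₃)) = 36 := by
  rw [← Real.sqrt_mul (by positivity)]
  have h : 3 ^ 3 * 8 / (c₀ * ℓ₃) * (2 * c₀ * (3 * ℓ₃)) = (36 : ℝ) ^ 2 := by field_simp; ring
  rw [h, Real.sqrt_sq (by norm_num)]

/-! ## §3 (E1) The phase-class constant `θ_V` is `≤ r·T + 10⁵·ε₀`, K-free -/

/-- ★★ **(E1) `θ_V ≤ r·T(a₁, C_K, δ_K) + 10⁵·ε₀`, K-FREE**: A2g's phase-class constant (as displayed by A2i ✓`kernelRow_GT_DeltaEtaSlot_of_lift_abs`, with `d = 3`,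
`CkD := C_K·ℓ⁻³`, `μ′ := δ_K`) is bounded member-uniformly once `a ≤ a₁(c₀∕cB)ℓ³`, `0 < r ≤ min ¼ (δ_K∕2)`: the `a`-part is `a·(cB∕(c₀ℓ³))·(12√216·E + 216E²)` with
`E = e^{4r} − 1 ≤ 8r`, the `hk_D`-part is `√2·C_K·(3re^{3r}∕m)·3·(2(1+1∕(δ_K − r − m)))³·(ℓ⁻³·ℓ³)`, the `ε₀`-part is `32√2·648·(1+e^{2r})·ε₀`.
[cite: Balaban1985BackgroundPropagators, (3.46)–(3.49) pp.398–399] -/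
theorem thetaV_le_kfree {d : ℕ} (hd : d = 3) {Lr : ℝ} (hLr : 1 ≤ Lr) (k : ℕ) {c₀ cB : ℝ} (hc₀ : 0 < c₀) (hcB : 0 < cB)
    {a a₁ : ℝ} (ha : 0 ≤ a) (ha₁ : a ≤ a₁ * (c₀ / cB) * (Lr ^ k) ^ 3) {CK δK : ℝ} (hCK : 0 ≤ CK) (hδK : 0 < δK)
    {r : ℝ} (hr : 0 < r) (hr4 : r ≤ 1 / 4) (hrδ : r ≤ δK / 2) {ε₀ : ℝ} (hε₀ : 0 ≤ ε₀) :
    (a * (2 * Real.sqrt (216 * (Real.exp (r * ((d : ℝ) + 1)) - 1) ^ 2 * (cB / (c₀ * (Lr ^ k) ^ 3))) * (6 * Real.sqrt (cB / c₀) * Real.sqrt ((Lr ^ k)⁻¹ ^ 3))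
          + 216 * (Real.exp (r * ((d : ℝ) + 1)) - 1) ^ 2 * (cB / (c₀ * (Lr ^ k) ^ 3)))
      + Real.sqrt 2 * (CK * (Lr ^ k)⁻¹ ^ 3) * (r * d * Real.exp (r * d) / min 1 ((δK - r) / 2))
          * ((d : ℝ) * ((Lr ^ d) ^ k) * (2 * (1 + 1 / (δK - (r + min 1 ((δK - r) / 2))))) ^ 3)
      + 32 * Real.sqrt 2 * ε₀ * ((d : ℝ) * (2 * 3) ^ d) * (1 + Real.exp (2 * r)))
      ≤ r * (5000 * a₁ + 27 * Real.sqrt 2 * CK * (2 * (1 + 4 / δK)) ^ 3 / min 1 (δK / 4)) + 10 ^ 5 * ε₀ := by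
  subst hd
  simp only [Nat.cast_ofNat]
  set ℓ : ℝ := Lr ^ k with hℓ
  have hℓ1 : 1 ≤ ℓ := one_le_pow₀ hLr
  have hℓ0 : 0 < ℓ := lt_of_lt_of_le one_pos hℓ1
  have hℓ3 : (Lr ^ 3) ^ k = ℓ ^ 3 := by rw [hℓ, ← pow_mul, ← pow_mul, mul_comm]
  have hinv : ℓ⁻¹ ^ 3 * ℓ ^ 3 = 1 := by rw [← mul_pow, inv_mul_cancel₀ hℓ0.ne', one_pow]
  rw [hℓ3]
  -- the `a`-part
  set E : ℝ := Real.exp (r * (3 + 1)) - 1 with hEdef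
  have hE0 : 0 ≤ E := exp_sub_one_nonneg (by positivity)
  have hE8 : E ≤ 8 * r := by
    have h4 : r * (3 + 1) = 4 * r := by ring
    rw [hEdef, h4]; exact exp_four_mul_sub_one_le hr.le hr4
  set q : ℝ := cB / (c₀ * ℓ ^ 3) with hq
  have hq0 : 0 < q := by rw [hq]; positivity
  have haq : a * q ≤ a₁ := by
    calc a * q ≤ (a₁ * (c₀ / cB) * ℓ ^ 3) * q := mul_le_mul_of_nonneg_right ha₁ hq0.le
      _ = a₁ := by rw [hq]; field_simp
  have ha₁0 : 0 ≤ a₁ := le_trans (mul_nonneg ha hq0.le) haq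
  have hsq : Real.sqrt (cB / c₀) * Real.sqrt (ℓ⁻¹ ^ 3) = Real.sqrt q := by
    rw [← Real.sqrt_mul (div_nonneg hcB.le hc₀.le)]
    congr 1
    rw [hq, inv_pow]; field_simp
  have hs216 : Real.sqrt (216 * E ^ 2 * q) = Real.sqrt 216 * E * Real.sqrt q := by
    rw [Real.sqrt_mul (by positivity : (0:ℝ) ≤ 216 * E ^ 2), Real.sqrt_mul (by norm_num : (0:ℝ) ≤ 216), Real.sqrt_sq hE0]
  have h1 : a * (2 * Real.sqrt (216 * E ^ 2 * q) * (6 * Real.sqrt (cB / c₀) * Real.sqrt (ℓ⁻¹ ^ 3)) + 216 * E ^ 2 * q) ≤ r * (5000 * a₁) := by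
    have hform : a * (2 * Real.sqrt (216 * E ^ 2 * q) * (6 * Real.sqrt (cB / c₀) * Real.sqrt (ℓ⁻¹ ^ 3)) + 216 * E ^ 2 * q)
        = (a * q) * (12 * Real.sqrt 216 * E + 216 * E ^ 2) := by
      rw [mul_assoc (6 : ℝ), hsq, hs216]
      have hqq : Real.sqrt q * Real.sqrt q = q := Real.mul_self_sqrt hq0.le
      calc a * (2 * (Real.sqrt 216 * E * Real.sqrt q) * (6 * Real.sqrt q) + 216 * E ^ 2 * q)
          = a * (12 * Real.sqrt 216 * E * (Real.sqrt q * Real.sqrt q) + 216 * E ^ 2 * q) := by ring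
        _ = (a * q) * (12 * Real.sqrt 216 * E + 216 * E ^ 2) := by rw [hqq]; ring
    rw [hform]
    have hpoly : 12 * Real.sqrt 216 * E + 216 * E ^ 2 ≤ 5000 * r := by
      have hE2 : E ^ 2 ≤ 16 * r := by
        calc E ^ 2 = E * E := sq E
          _ ≤ 2 * (8 * r) := mul_le_mul (hE8.trans (by linarith)) hE8 hE0 (by norm_num)
          _ = 16 * r := by ring
      have hsE : Real.sqrt 216 * E ≤ 15 * (8 * r) := mul_le_mul sqrt_216_le hE8 hE0 (by norm_num)
      have h12 : 12 * Real.sqrt 216 * E = 12 * (Real.sqrt 216 * E) := by ring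
      rw [h12]
      linarith
    calc (a * q) * (12 * Real.sqrt 216 * E + 216 * E ^ 2) ≤ a₁ * (5000 * r) :=
          mul_le_mul haq hpoly (by positivity) ha₁0
      _ = r * (5000 * a₁) := by ring
  -- the `hk_D`-part
  set m : ℝ := min 1 ((δK - r) / 2) with hm
  have hm4 : min 1 (δK / 4) ≤ m := by rw [hm]; exact min_le_min_left 1 (by linarith)
  have hm₀ : 0 < min 1 (δK / 4) := lt_min one_pos (by positivity)
  have hm0 : 0 < m := lt_of_lt_of_le hm₀ hm4
  have hmle : m ≤ (δK - r) / 2 := min_le_right _ _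
  have hx : δK / 4 ≤ δK - (r + m) := by linarith
  have hx0 : 0 < δK - (r + m) := lt_of_lt_of_le (by positivity) hx
  have hV : (2 * (1 + 1 / (δK - (r + m)))) ^ 3 ≤ (2 * (1 + 4 / δK)) ^ 3 := by
    have h1x : 1 / (δK - (r + m)) ≤ 4 / δK := by
      rw [div_le_div_iff₀ hx0 hδK]; linarith
    gcongr
  have he3 : Real.exp (r * 3) ≤ 3 := le_trans (Real.exp_le_exp.mpr (by linarith)) exp_three_quarters_le_three
  have hA : r * 3 * Real.exp (r * 3) / m ≤ r * 9 / min 1 (δK / 4) := by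
    rw [div_le_div_iff₀ hm0 hm₀]
    have h9 : r * 3 * Real.exp (r * 3) ≤ r * 9 := by
      calc r * 3 * Real.exp (r * 3) ≤ r * 3 * 3 := mul_le_mul_of_nonneg_left he3 (by positivity)
        _ = r * 9 := by ring
    calc r * 3 * Real.exp (r * 3) * min 1 (δK / 4) ≤ r * 9 * min 1 (δK / 4) := mul_le_mul_of_nonneg_right h9 hm₀.le
      _ ≤ r * 9 * m := mul_le_mul_of_nonneg_left hm4 (by positivity)
  have h3 : Real.sqrt 2 * (CK * ℓ⁻¹ ^ 3) * (r * 3 * Real.exp (r * 3) / m) * (3 * ℓ ^ 3 * (2 * (1 + 1 / (δK - (r + m)))) ^ 3)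
      ≤ r * (27 * Real.sqrt 2 * CK * (2 * (1 + 4 / δK)) ^ 3 / min 1 (δK / 4)) := by
    have hform : Real.sqrt 2 * (CK * ℓ⁻¹ ^ 3) * (r * 3 * Real.exp (r * 3) / m) * (3 * ℓ ^ 3 * (2 * (1 + 1 / (δK - (r + m)))) ^ 3)
        = 3 * Real.sqrt 2 * CK * ((r * 3 * Real.exp (r * 3) / m) * (2 * (1 + 1 / (δK - (r + m)))) ^ 3) * (ℓ⁻¹ ^ 3 * ℓ ^ 3) := by ring
    rw [hform, hinv, mul_one]
    have hprod : (r * 3 * Real.exp (r * 3) / m) * (2 * (1 + 1 / (δK - (r + m)))) ^ 3 ≤ (r * 9 / min 1 (δK / 4)) * (2 * (1 + 4 / δK)) ^ 3 :=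
      mul_le_mul hA hV (by positivity) (by positivity)
    calc 3 * Real.sqrt 2 * CK * ((r * 3 * Real.exp (r * 3) / m) * (2 * (1 + 1 / (δK - (r + m)))) ^ 3)
        ≤ 3 * Real.sqrt 2 * CK * ((r * 9 / min 1 (δK / 4)) * (2 * (1 + 4 / δK)) ^ 3) := mul_le_mul_of_nonneg_left hprod (by positivity)
      _ = r * (27 * Real.sqrt 2 * CK * (2 * (1 + 4 / δK)) ^ 3 / min 1 (δK / 4)) := by
          field_simp
          ring
  -- the `ε₀`-part
  have h4 : 32 * Real.sqrt 2 * ε₀ * (3 * (2 * 3) ^ 3) * (1 + Real.exp (2 * r)) ≤ 10 ^ 5 * ε₀ := by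
    have he2 : Real.exp (2 * r) ≤ 2 := le_trans (Real.exp_le_exp.mpr (by linarith)) exp_half_le_two
    have h32 : 32 * Real.sqrt 2 * ε₀ * (3 * (2 * 3) ^ 3) * (1 + Real.exp (2 * r)) ≤ 32 * Real.sqrt 2 * ε₀ * (3 * (2 * 3) ^ 3) * 3 :=
      mul_le_mul_of_nonneg_left (by linarith) (by positivity)
    have hre : 32 * Real.sqrt 2 * ε₀ * (3 * (2 * 3) ^ 3) * 3 = 62208 * (Real.sqrt 2 * ε₀) := by ring
    have hs2 : Real.sqrt 2 * ε₀ ≤ 3 / 2 * ε₀ := mul_le_mul_of_nonneg_right sqrt_two_le hε₀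
    rw [hre] at h32
    linarith
  have hsum := add_le_add (add_le_add h1 h3) h4
  refine hsum.trans (le_of_eq ?_)
  ring

/-! ## §4 (E2) The conclusion constant `2A₂` is `≤ C_G(γ, C_K, δ_K, a₁, r)`, K-free; the window `S ≤ ½` -/

/-- ★ `S := (32√2ε₀e^{5r})(8e^{3r})·14 ≤ ½` once `r ≤ ¼` and `ε₀ ≤ 10⁻⁵` (`e^{8r} ≤ e² ≤ 7.39`, `√2 ≤ 3∕2`). [folklore] -/
theorem hsmall_le_half {r ε₀ : ℝ} (hr4 : r ≤ 1 / 4) (hε₀ : 0 ≤ ε₀) (hε5 : ε₀ ≤ (10 : ℝ)⁻¹ ^ 5) :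
    (32 * Real.sqrt 2 * ε₀ * Real.exp (5 * r)) * (8 * Real.exp (3 * r)) * 14 ≤ 1 / 2 := by
  have he : Real.exp (5 * r) * Real.exp (3 * r) ≤ 7.39 := by
    rw [← Real.exp_add]
    exact le_trans (Real.exp_le_exp.mpr (by linarith)) exp_two_le
  have hform : (32 * Real.sqrt 2 * ε₀ * Real.exp (5 * r)) * (8 * Real.exp (3 * r)) * 14 = 3584 * (Real.sqrt 2 * ε₀) * (Real.exp (5 * r) * Real.exp (3 * r)) := by
    ring
  rw [hform]
  have hs2 : Real.sqrt 2 * ε₀ ≤ 3 / 2 * ε₀ := mul_le_mul_of_nonneg_right sqrt_two_le hε₀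
  have h1 : 3584 * (Real.sqrt 2 * ε₀) * (Real.exp (5 * r) * Real.exp (3 * r)) ≤ 3584 * (3 / 2 * ε₀) * 7.39 :=
    mul_le_mul (mul_le_mul_of_nonneg_left hs2 (by norm_num)) he (by positivity) (by positivity)
  have h2 : 3584 * (3 / 2 * ε₀) * 7.39 ≤ 1 / 2 := by
    have : ε₀ ≤ 1 / 100000 := le_trans hε5 (by norm_num)
    linarith
  linarith

/-- ★★ **(E2) `2A₂ ≤ C_G(γ, C_K, δ_K, a₁, r)`, K-FREE**: the (K2-L1)∕N4 conclusion constant (with `d = 3`, `CkD := C_K·ℓ⁻³`, `CkQ := 2a·5²(cB∕c₀)ℓ⁻⁶e^{δ_K}`, `μ′ := δ_K`, any `Θ ≥ γ∕2`)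
is bounded member-uniformly once `a ≤ a₁(c₀∕cB)ℓ³`, `0 < r ≤ min ¼ (δ_K∕2)`, `ε₀ ≤ 10⁻⁵`: the cancellations `√(3ℓ³∕c₀)·√(2c₀·3ℓ³) = 3√2ℓ³`, `(CkQ + C_Kℓ⁻³)·ℓ³ ≤ 50a₁e^{δ_K} + C_K`,
`√(216∕(c₀ℓ³))·√(2c₀·3ℓ³) = 36`, `1∕(1 − S) ≤ 2`. [cite: Balaban1985BackgroundPropagators, (3.46)–(3.49) pp.398–399] -/
theorem twoA₂_le_kfree {d : ℕ} (hd : d = 3) {Lr : ℝ} (hLr : 1 ≤ Lr) (k : ℕ) {c₀ cB : ℝ} (hc₀ : 0 < c₀) (hcB : 0 < cB)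
    {a a₁ : ℝ} (ha : 0 ≤ a) (ha₁ : a ≤ a₁ * (c₀ / cB) * (Lr ^ k) ^ 3) {CK δK : ℝ} (hCK : 0 ≤ CK) (hδK : 0 < δK)
    {r : ℝ} (hr : 0 < r) (hr4 : r ≤ 1 / 4) (hrδ : r ≤ δK / 2) {γ Θ : ℝ} (hγ : 0 < γ) (hΘ : γ / 2 ≤ Θ)
    {ε₀ : ℝ} (hε₀ : 0 ≤ ε₀) (hε5 : ε₀ ≤ (10 : ℝ)⁻¹ ^ 5) :
    2 * (((Real.sqrt 2 + Real.sqrt 2 * (((2 * a * 5 ^ 2 * (cB / c₀) * (Lr ^ k)⁻¹ ^ 6 * Real.exp δK) + CK * (Lr ^ k)⁻¹ ^ 3)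
            * Real.sqrt ((d : ℝ) * ((Lr ^ d) ^ k) / c₀) * (Real.exp (6 * r) * Real.sqrt (2 * c₀ * ((d : ℝ) * ((Lr ^ d) ^ k))) / Θ) * (2 * (1 + 1 / (δK - r))) ^ 3))
              * (8 * Real.exp (3 * r)) * 14
          + Real.sqrt (3 ^ 3 * 8 / (c₀ * (Lr ^ k) ^ 3)) * (Real.sqrt (8 * Real.exp (3 * r) * (2 * (1 + 1 / r)) ^ 3) * (Real.exp (6 * r) * Real.sqrt (2 * c₀ * ((d : ℝ) * ((Lr ^ d) ^ k))) / Θ)))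
        / (1 - (32 * Real.sqrt 2 * ε₀ * Real.exp (5 * r)) * (8 * Real.exp (3 * r)) * 14))
      ≤ 4 * ((Real.sqrt 2 + Real.sqrt 2 * ((50 * a₁ * Real.exp δK + CK) * (3 * Real.sqrt 2) * (Real.exp (6 * r) * (2 / γ)) * (2 * (1 + 2 / δK)) ^ 3))
              * (8 * Real.exp (3 * r)) * 14
            + 36 * (Real.sqrt (8 * Real.exp (3 * r) * (2 * (1 + 1 / r)) ^ 3) * (Real.exp (6 * r) * (2 / γ)))) := by
  subst hd
  simp only [Nat.cast_ofNat]
  set ℓ : ℝ := Lr ^ k with hℓ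
  have hℓ1 : 1 ≤ ℓ := one_le_pow₀ hLr
  have hℓ0 : 0 < ℓ := lt_of_lt_of_le one_pos hℓ1
  have hℓ3 : (Lr ^ 3) ^ k = ℓ ^ 3 := by rw [hℓ, ← pow_mul, ← pow_mul, mul_comm]
  have hinv : ℓ⁻¹ ^ 3 * ℓ ^ 3 = 1 := by rw [← mul_pow, inv_mul_cancel₀ hℓ0.ne', one_pow]
  rw [hℓ3]
  have hΘ0 : 0 < Θ := lt_of_lt_of_le (by positivity) hΘ
  have hΘinv : 1 / Θ ≤ 2 / γ := by rw [div_le_div_iff₀ hΘ0 hγ]; linarith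
  -- the coupling∕`hk_D` letters times the block volume
  set q : ℝ := cB / (c₀ * ℓ ^ 3) with hq
  have hq0 : 0 < q := by rw [hq]; positivity
  have haq : a * q ≤ a₁ := by
    calc a * q ≤ (a₁ * (c₀ / cB) * ℓ ^ 3) * q := mul_le_mul_of_nonneg_right ha₁ hq0.le
      _ = a₁ := by rw [hq]; field_simp
  have ha₁0 : 0 ≤ a₁ := le_trans (mul_nonneg ha hq0.le) haq
  have hQ : (2 * a * 5 ^ 2 * (cB / c₀) * ℓ⁻¹ ^ 6 * Real.exp δK + CK * ℓ⁻¹ ^ 3) * ℓ ^ 3 ≤ 50 * a₁ * Real.exp δK + CK := by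
    have hform : (2 * a * 5 ^ 2 * (cB / c₀) * ℓ⁻¹ ^ 6 * Real.exp δK + CK * ℓ⁻¹ ^ 3) * ℓ ^ 3
        = 50 * (a * q) * Real.exp δK + CK * (ℓ⁻¹ ^ 3 * ℓ ^ 3) := by
      rw [hq, inv_pow]; field_simp; ring
    rw [hform, hinv, mul_one]
    have := mul_le_mul_of_nonneg_right (mul_le_mul_of_nonneg_left haq (by norm_num : (0:ℝ) ≤ 50)) (Real.exp_pos δK).le
    linarith
  -- the two cancellations
  have hN := sqrt_vol_mul_sqrt_mass_eq hc₀ (pow_nonneg hℓ0.le 3)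
  have h36 := sqrt_inv_vol_mul_sqrt_mass_eq hc₀ (pow_pos hℓ0 3)
  -- the volume factor `Vr`
  have hx0 : 0 < δK - r := by linarith
  have hV : (2 * (1 + 1 / (δK - r))) ^ 3 ≤ (2 * (1 + 2 / δK)) ^ 3 := by
    have h1x : 1 / (δK - r) ≤ 2 / δK := by rw [div_le_div_iff₀ hx0 hδK]; linarith
    gcongr
  -- T: the first product
  have hT : (2 * a * 5 ^ 2 * (cB / c₀) * ℓ⁻¹ ^ 6 * Real.exp δK + CK * ℓ⁻¹ ^ 3) * Real.sqrt (3 * ℓ ^ 3 / c₀)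
        * (Real.exp (6 * r) * Real.sqrt (2 * c₀ * (3 * ℓ ^ 3)) / Θ) * (2 * (1 + 1 / (δK - r))) ^ 3
      ≤ (50 * a₁ * Real.exp δK + CK) * (3 * Real.sqrt 2) * (Real.exp (6 * r) * (2 / γ)) * (2 * (1 + 2 / δK)) ^ 3 := by
    have hform : (2 * a * 5 ^ 2 * (cB / c₀) * ℓ⁻¹ ^ 6 * Real.exp δK + CK * ℓ⁻¹ ^ 3) * Real.sqrt (3 * ℓ ^ 3 / c₀)
          * (Real.exp (6 * r) * Real.sqrt (2 * c₀ * (3 * ℓ ^ 3)) / Θ) * (2 * (1 + 1 / (δK - r))) ^ 3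
        = (2 * a * 5 ^ 2 * (cB / c₀) * ℓ⁻¹ ^ 6 * Real.exp δK + CK * ℓ⁻¹ ^ 3)
          * (Real.sqrt (3 * ℓ ^ 3 / c₀) * Real.sqrt (2 * c₀ * (3 * ℓ ^ 3))) * (Real.exp (6 * r) * (1 / Θ)) * (2 * (1 + 1 / (δK - r))) ^ 3 := by
      field_simp
    rw [hform, hN]
    have hform2 : (2 * a * 5 ^ 2 * (cB / c₀) * ℓ⁻¹ ^ 6 * Real.exp δK + CK * ℓ⁻¹ ^ 3) * (3 * Real.sqrt 2 * ℓ ^ 3) * (Real.exp (6 * r) * (1 / Θ)) * (2 * (1 + 1 / (δK - r))) ^ 3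
        = ((2 * a * 5 ^ 2 * (cB / c₀) * ℓ⁻¹ ^ 6 * Real.exp δK + CK * ℓ⁻¹ ^ 3) * ℓ ^ 3) * (3 * Real.sqrt 2) * (Real.exp (6 * r) * (1 / Θ)) * (2 * (1 + 1 / (δK - r))) ^ 3 := by
      ring
    rw [hform2]
    have hE : Real.exp (6 * r) * (1 / Θ) ≤ Real.exp (6 * r) * (2 / γ) := mul_le_mul_of_nonneg_left hΘinv (Real.exp_pos _).le
    have hQ0 : 0 ≤ (2 * a * 5 ^ 2 * (cB / c₀) * ℓ⁻¹ ^ 6 * Real.exp δK + CK * ℓ⁻¹ ^ 3) * ℓ ^ 3 := by positivity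
    gcongr
  -- U: the second product
  have hU : Real.sqrt (3 ^ 3 * 8 / (c₀ * ℓ ^ 3)) * (Real.sqrt (8 * Real.exp (3 * r) * (2 * (1 + 1 / r)) ^ 3) * (Real.exp (6 * r) * Real.sqrt (2 * c₀ * (3 * ℓ ^ 3)) / Θ))
      ≤ 36 * (Real.sqrt (8 * Real.exp (3 * r) * (2 * (1 + 1 / r)) ^ 3) * (Real.exp (6 * r) * (2 / γ))) := by
    have hform : Real.sqrt (3 ^ 3 * 8 / (c₀ * ℓ ^ 3)) * (Real.sqrt (8 * Real.exp (3 * r) * (2 * (1 + 1 / r)) ^ 3) * (Real.exp (6 * r) * Real.sqrt (2 * c₀ * (3 * ℓ ^ 3)) / Θ))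
        = (Real.sqrt (3 ^ 3 * 8 / (c₀ * ℓ ^ 3)) * Real.sqrt (2 * c₀ * (3 * ℓ ^ 3))) * (Real.sqrt (8 * Real.exp (3 * r) * (2 * (1 + 1 / r)) ^ 3) * (Real.exp (6 * r) * (1 / Θ))) := by
      field_simp
    rw [hform, h36]
    have hE : Real.exp (6 * r) * (1 / Θ) ≤ Real.exp (6 * r) * (2 / γ) := mul_le_mul_of_nonneg_left hΘinv (Real.exp_pos _).le
    gcongr
  -- numerator and denominator
  have hS := hsmall_le_half hr4 hε₀ hε5
  have hden : (1 : ℝ) / 2 ≤ 1 - (32 * Real.sqrt 2 * ε₀ * Real.exp (5 * r)) * (8 * Real.exp (3 * r)) * 14 := by linarith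
  have hnum : (Real.sqrt 2 + Real.sqrt 2 * ((2 * a * 5 ^ 2 * (cB / c₀) * ℓ⁻¹ ^ 6 * Real.exp δK + CK * ℓ⁻¹ ^ 3) * Real.sqrt (3 * ℓ ^ 3 / c₀)
          * (Real.exp (6 * r) * Real.sqrt (2 * c₀ * (3 * ℓ ^ 3)) / Θ) * (2 * (1 + 1 / (δK - r))) ^ 3)) * (8 * Real.exp (3 * r)) * 14
        + Real.sqrt (3 ^ 3 * 8 / (c₀ * ℓ ^ 3)) * (Real.sqrt (8 * Real.exp (3 * r) * (2 * (1 + 1 / r)) ^ 3) * (Real.exp (6 * r) * Real.sqrt (2 * c₀ * (3 * ℓ ^ 3)) / Θ))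
      ≤ (Real.sqrt 2 + Real.sqrt 2 * ((50 * a₁ * Real.exp δK + CK) * (3 * Real.sqrt 2) * (Real.exp (6 * r) * (2 / γ)) * (2 * (1 + 2 / δK)) ^ 3)) * (8 * Real.exp (3 * r)) * 14
        + 36 * (Real.sqrt (8 * Real.exp (3 * r) * (2 * (1 + 1 / r)) ^ 3) * (Real.exp (6 * r) * (2 / γ))) := by
    have h1 : Real.sqrt 2 * ((2 * a * 5 ^ 2 * (cB / c₀) * ℓ⁻¹ ^ 6 * Real.exp δK + CK * ℓ⁻¹ ^ 3) * Real.sqrt (3 * ℓ ^ 3 / c₀)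
          * (Real.exp (6 * r) * Real.sqrt (2 * c₀ * (3 * ℓ ^ 3)) / Θ) * (2 * (1 + 1 / (δK - r))) ^ 3)
        ≤ Real.sqrt 2 * ((50 * a₁ * Real.exp δK + CK) * (3 * Real.sqrt 2) * (Real.exp (6 * r) * (2 / γ)) * (2 * (1 + 2 / δK)) ^ 3) :=
      mul_le_mul_of_nonneg_left hT (Real.sqrt_nonneg 2)
    have h2 := mul_le_mul_of_nonneg_right (mul_le_mul_of_nonneg_right (add_le_add (le_refl (Real.sqrt 2)) h1) (by positivity : (0:ℝ) ≤ 8 * Real.exp (3 * r)))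
      (by norm_num : (0:ℝ) ≤ 14)
    exact add_le_add h2 hU
  have hnum0 : 0 ≤ (Real.sqrt 2 + Real.sqrt 2 * ((2 * a * 5 ^ 2 * (cB / c₀) * ℓ⁻¹ ^ 6 * Real.exp δK + CK * ℓ⁻¹ ^ 3) * Real.sqrt (3 * ℓ ^ 3 / c₀)
          * (Real.exp (6 * r) * Real.sqrt (2 * c₀ * (3 * ℓ ^ 3)) / Θ) * (2 * (1 + 1 / (δK - r))) ^ 3)) * (8 * Real.exp (3 * r)) * 14
        + Real.sqrt (3 ^ 3 * 8 / (c₀ * ℓ ^ 3)) * (Real.sqrt (8 * Real.exp (3 * r) * (2 * (1 + 1 / r)) ^ 3) * (Real.exp (6 * r) * Real.sqrt (2 * c₀ * (3 * ℓ ^ 3)) / Θ)) := by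
    positivity
  rw [div_eq_mul_one_div]
  have hinv2 : 1 / (1 - (32 * Real.sqrt 2 * ε₀ * Real.exp (5 * r)) * (8 * Real.exp (3 * r)) * 14) ≤ 2 := by
    rw [div_le_iff₀ (lt_of_lt_of_le (by norm_num) hden)]; linarith
  have hfin := mul_le_mul hnum hinv2 (by positivity) (hnum0.trans hnum)
  linarith

/-! ## §5 The quarter-budgets: `Θ ≥ γ∕2` -/

/-- ★ The `r`-budget: `3r²e^{2r}(1+1∕ε) ≤ γ∕16` once `0 < r ≤ ¼`, `0 < ε ≤ 1`, `r ≤ γε∕48`. [folklore] -/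
theorem rbudget_le {γ r ε : ℝ} (hγ : 0 ≤ γ) (hr : 0 < r) (hr4 : r ≤ 1 / 4) (hε : 0 < ε) (hε1 : ε ≤ 1) (hrγ : r ≤ γ * ε / 48) :
    3 * (r ^ 2 * Real.exp (2 * r)) * (1 + 1 / ε) ≤ γ / 16 := by
  have he2 : Real.exp (2 * r) ≤ 2 := le_trans (Real.exp_le_exp.mpr (by linarith)) exp_half_le_two
  have h1 : 3 * (r ^ 2 * Real.exp (2 * r)) * (1 + 1 / ε) ≤ 3 * (r ^ 2 * 2) * (1 + 1 / ε) := by gcongr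
  have h2 : 3 * (r ^ 2 * 2) * (1 + 1 / ε) = 6 * r * (r * (1 + 1 / ε)) := by ring
  have h3 : r * (1 + 1 / ε) ≤ γ * ε / 48 * (1 + 1 / ε) := mul_le_mul_of_nonneg_right hrγ (by positivity)
  have h4 : γ * ε / 48 * (1 + 1 / ε) = γ / 48 * (ε + 1) := by field_simp
  have h5 : γ / 48 * (ε + 1) ≤ γ / 48 * 2 := mul_le_mul_of_nonneg_left (by linarith) (by positivity)
  rw [h2] at h1
  rw [h4] at h3
  have h6 : 6 * r * (r * (1 + 1 / ε)) ≤ 6 * (1 / 4) * (γ / 48 * 2) :=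
    mul_le_mul (by linarith) (h3.trans h5) (by positivity) (by positivity)
  linarith

/-- ★★ **`Θ ≥ γ∕2` FROM THE FOUR QUARTER-BUDGETS**: `ε ≤ ⅛`, `ε·C_V ≤ γ∕8`, `3r²e^{2r}(1+1∕ε) ≤ γ∕8`, `θ_V ≤ γ∕8` give
`γ∕2 ≤ (1 − ε)γ − εC_V − 3r²e^{2r}(1+1∕ε) − θ_V` (the `0 < Θ` letter of A2i∕N4∕(K2-L1), quantitatively; `γ ≥ 0`). [cite: Balaban1985BackgroundPropagators, Thm 3.11 p.416] -/
theorem theta_ge_half_of_budgets {γ ε CV θV r : ℝ} (hγ : 0 ≤ γ) (hε8 : ε ≤ 1 / 8) (hεC : ε * CV ≤ γ / 8)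
    (hR : 3 * (r ^ 2 * Real.exp (2 * r)) * (1 + 1 / ε) ≤ γ / 8) (hθ : θV ≤ γ / 8) :
    γ / 2 ≤ (1 - ε) * γ - ε * CV - 3 * (r ^ 2 * Real.exp (2 * r)) * (1 + 1 / ε) - θV := by
  have hεγ : ε * γ ≤ 1 / 8 * γ := mul_le_mul_of_nonneg_right hε8 hγ
  nlinarith

/-- ★ The absolute (C_V) of A2h at `ε₀ ≤ 1`, `d = 3`: `C_V(ε₀) ≤ 32√2·648 + (33∕8)²·600·(27∕4)⁶`. [cite: Balaban1985BackgroundPropagators, (3.69) p.404] -/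
theorem CV_abs_le {d : ℕ} (hd : d = 3) {ε₀ : ℝ} (hε1 : ε₀ ≤ 1) :
    (32 * Real.sqrt 2 * ε₀ * ((d : ℝ) * (2 * 3) ^ d)) + (33 / 8 : ℝ) ^ 2 * (600 * (27 / 4 : ℝ) ^ 6)
      ≤ 32 * Real.sqrt 2 * 648 + (33 / 8 : ℝ) ^ 2 * (600 * (27 / 4 : ℝ) ^ 6) := by
  subst hd
  simp only [Nat.cast_ofNat]
  have h : 32 * Real.sqrt 2 * ε₀ * (3 * (2 * 3) ^ 3) = (32 * Real.sqrt 2 * 648) * ε₀ := by ring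
  rw [h]
  nlinarith [Real.sqrt_nonneg 2]

end Summit.QuantumFields.YangMills.Theorems.Prop7OneFormGreenKFreeNumerics

end
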